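/-
Copyright: lit-balaban Phase-2 proof seat p30 (gen 6).  Statement-level skeleton of a published paper; no proof claims beyond what
the kernel checks below.
-/
import Literature.MathematicalPhysics.QuantumFieldTheory.BalabanImbrieJaffe1984to88.BIJ85ScalarPropagatorTorusK
import Literature.MathematicalPhysics.QuantumFieldTheory.BalabanImbrieJaffe1984to88.BIJ88BlockGauge417

/-!
# `BalabanImbrieJaffe1984to88.BIJ85Eq634Torus` — T. Bałaban, J. Imbrie, A. Jaffe, *Renormalization of the Higgs model: minimizers,
propagators and the stability of mean field theory*, Commun. Math. Phys. **97** (1985) 299–329 [BalabanImbrieJaffe1985]: Sect. 6.3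
**(6.3.3) ⇒ (6.3.4) AT THE TORUS MODEL INSTANCE, FOR THE EXPLICIT QUADRATIC BOSON ACTION** — the scalar field integral `∫𝒟φ F(S(u_k, φ) +
½a‖ψ − Q(u_k)φ‖²)` over the Higgs fields of the torus `T^{(j)}` (Lebesgue measure `𝒟φ`), with `S(u, φ) = ½‖D_uφ‖²` the explicit quadratic form
(3.25)/(4.6.1) for which (6.3.2) IS proved (seat p11's `BIJ85ScalarPropagatorTorusK.scalarForm_gaugeAct`), equals after the gauge change of
variables `φ = hφ′` (measure preserving: seat p34's `BIJ85RT33.measurePreserving_twist`, as the change-of-variables lemma `BIJ88BlockGauge417.integral_comp_twist` of seat r18) the integral with `u_k` replaced by `u′`, `u_k = (u′)^h`,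
and `ψ` by `h^{−1}ψ` read at the block corners — seat p30's abstract `BIJ85Eq634Proof.eq634` with its hypotheses (6.3.2) `h632` and (2.8) `h28`
DISCHARGED on the tori for the quadratic action, NO hypothesis left

statement-level skeleton of published theorems with citation tags; proofs where landed; nothing here is a claim about the Yang–Mills mass gap

PDF held: `paper:balaban1985-cmp97-bij-higgs-minimizers` (journal page = PDF page + 298).  Pages read as images: p. 320 [PDF 22]
(`HOME/lit-balaban-r15/pages/1985-cmp97-bij-higgs-minimizers-p022-x2.png`), p. 313 [PDF 15].

CITATION HEADER (lean-in-tree rule).  Part of the lit-balaban TYPED SKELETON (HOME `run/shared/lean/pub/lit-balaban/`), Phase-2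
seat p30 (gen 6), unit `lit-balaban-p30`; WHAT IS REPRODUCED = row **C1.Eq6.3.1-6.3.4** (members (6.3.3)–(6.3.4), and (6.3.2) as used) of
`HOME/SKELETON.md` (reader file `HOME/lit-balaban-r15/ROWS-C1.md`) AT THE TORUS MODEL OF RECORD (kind «model-instance»; the carriers of the
scalar sector are seat p11's `FineSp`/`CoarseSpK`/`Dlin`/`QlinK` over `GaugeField P j U1`, `HiggsField P j`).

THE PRINTED TEXT (p. 320 [PDF 22], verbatim): *"Notice that every step of our construction has been gauge covariant, which ensures that
S_k(u_ke^{−iη∂λ}, e^{iλ}φ) = S_k(u_k, φ). (6.3.2) While we do not prove this invariance here, it is clear in the case of the quadratic forms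
for which we write explicit formulas. The scalar field integral has the form ∫𝒟φ exp{−[S_k(u_k, φ) + ½a‖ψ − Q(u_k)φ‖²]}. (6.3.3) If we
apply the decomposition (6.3.1) for u_k, and the gauge invariance (6.3.2), then (6.3.3) becomes ∫𝒟φ exp(−[S_k(u_{k+1}e^{ie_kηH_kB}, φ) +
½a‖e^{−iω}ψ − Q(u_{k+1}e^{ie_kηH_kB})φ‖²]). (6.3.4)"*

THE TYPING.  Torus `T^{(j)}` (fine lattice) with k-fold covariant block averages `Q_k(u) = QlinK u k` ((2.6)/(4.6.1), values on `T^{(j+k)}`,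
seat r18/p11), covariant derivative `D_u = Dlin c u`, the explicit quadratic exponent `scalarForm (Dlin c u) (QlinK u k) a ψ φ = ½a‖Q_k(u)φ −
ψ‖² + ½‖D_uφ‖²` (`BIJ85ScalarForm464.scalarForm`; = `S(u, φ) + ½a‖ψ − Q(u)φ‖²` for the quadratic `S(u, φ) = ½‖D_uφ‖²` of (3.25)), U(1) gauge
transformations `h : GaugeTransf P j U1` acting by `u ↦ u^h = gaugeAct h u` and `φ ↦ hφ = twist h φ` ((2.7)); `u_k = (u′)^h` is (6.3.1) with
`u′ = u_{k+1}e^{ie_kηH_kB}` and `h = e^{iω}` (transcript note T8 of `BIJ85Eq634Proof`: the printed `e^{−iω}ψ` is `h^{−1}ψ`, read at the corner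
points of the k-blocks, `cornerIter k`); `𝒟φ` = Lebesgue measure `volume` on `HiggsField P j = T^{(j)} → ℂ`; `F : ℝ → ℝ` arbitrary (the printed
`F = exp(−·)`).  WHAT IS PROVED: `twist_twist_inv` (with r18's `twist_inv_twist`: hφ is a bijection), **`eq634_torus`** ((6.3.3) = (6.3.4) on the tori for the
quadratic action, every `F`), `eq634_torus_exp` (the printed `F = exp(−·)`).  NOT covered (as in print and in the row): the non-quadratic parts of
the general-k `S_k`, which are not typed; for them (6.3.2) stays the hypothesis of `BIJ85Eq634Proof.eq634`.  D-0026: theorems only, no `def`,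
no new named fact.  Unit `lit-balaban-p30` (literature-prover-lit-balaban-p30-g6-0), 2026-08-21.
-/

open scoped BigOperators RealInnerProductSpace

namespace Literature.MathematicalPhysics.QuantumFieldTheory.BalabanImbrieJaffe1984to88.BIJ85Eq634Torus

open MeasureTheory
open Literature.MathematicalPhysics.QuantumFieldTheory.Balaban1983to89
open BIJ88Sect3Statements (U1 toC toC_mul toC_one norm_toC)
open BIJ85Sect1Model (HiggsField)
open BIJ85BlockAveragesTorus BIJ85BlockAveragesTorusK BIJ85ScalarPropagatorTorus BIJ85ScalarForm464 BIJ85ScalarPropagatorTorusK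
  BIJ85RT33 BIJ88BlockGauge417

noncomputable section

variable {P : Params} {j : ℕ}

/-! ## 1. `φ ↦ hφ` is a bijection of the Higgs fields; the change of variables is seat r18's `BIJ88BlockGauge417.integral_comp_twist` -/

/-- `h(h^{−1}φ) = φ`. [cite: BalabanImbrieJaffe1985, (2.7) p.303] -/
theorem twist_twist_inv (h : GaugeTransf P j U1) (φ : HiggsField P j) : twist h (twist (fun x => (h x)⁻¹) φ) = φ := by
  funext x
  rw [twist_apply, twist_apply, ← mul_assoc, ← toC_mul, mul_inv_cancel, toC_one, one_mul]

/-! ## 2. (6.3.3) ⇒ (6.3.4) for the explicit quadratic boson action -/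

/-- **(6.3.3) ⇒ (6.3.4) ON THE TORI, QUADRATIC BOSON ACTION** p. 320 [PDF 22]: for every U(1) gauge field `u′` of `T^{(j)}`, every gauge
transformation `h` (so `u_k = (u′)^h`, (6.3.1) with `h = e^{iω}`, `u′ = u_{k+1}e^{ie_kηH_kB}`), every unit-lattice field `ψ` and every `F`:
`∫𝒟φ F(½‖D_{u_k}φ‖² + ½a‖ψ − Q_k(u_k)φ‖²) = ∫𝒟φ F(½‖D_{u′}φ‖² + ½a‖h^{−1}ψ − Q_k(u′)φ‖²)` (`h^{−1}ψ` at the block corners, `(h^{−1}ψ)(y) =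
h(cornerIter k y)^{−1}ψ(y)` — the printed `e^{−iω}ψ`), by the change of variables `φ = hφ′` (r18's `integral_comp_twist`, p34's `measurePreserving_twist`) and (6.3.2) for the
quadratic forms (p11's `scalarForm_gaugeAct`, from (2.8)_k and `(D_{u^h}hφ)_b = h(b₋)(D_uφ)_b`); standing range `j + k ≤ m + K`.
[cite: BalabanImbrieJaffe1985, (6.3.3)–(6.3.4) p.320] -/
theorem eq634_torus {k : ℕ} (hk : j + k ≤ P.m + P.K) (c a : ℝ) (h : GaugeTransf P j U1) (u' : GaugeField P j U1)
    (ψ ψinv : CoarseSpK P j k) (hψinv : ∀ y, ψ y = toC (h (cornerIter k y)) * ψinv y) (F : ℝ → ℝ) :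
    ∫ φ : HiggsField P j, F (scalarForm (Dlin c (GaugeField.gaugeAct h u')) (QlinK (GaugeField.gaugeAct h u') k) a ψ
        (WithLp.toLp 2 φ)) =
      ∫ φ : HiggsField P j, F (scalarForm (Dlin c u') (QlinK u' k) a ψinv (WithLp.toLp 2 φ)) := by
  rw [← integral_comp_twist h (fun φ => F (scalarForm (Dlin c (GaugeField.gaugeAct h u')) (QlinK (GaugeField.gaugeAct h u') k) a ψ
    (WithLp.toLp 2 φ)))]
  refine integral_congr_ae (Filter.Eventually.of_forall fun φ => ?_)
  exact congrArg F (scalarForm_gaugeAct hk c a h u' hψinv (WithLp.toLp 2 φ))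

/-- **(6.3.3) ⇒ (6.3.4) with the printed `F = exp(−·)`**: `∫𝒟φ exp{−[½‖D_{u_k}φ‖² + ½a‖ψ − Q_k(u_k)φ‖²]} = ∫𝒟φ exp(−[½‖D_{u′}φ‖² +
½a‖h^{−1}ψ − Q_k(u′)φ‖²])`, `u_k = (u′)^h`. [cite: BalabanImbrieJaffe1985, (6.3.4) p.320] -/
theorem eq634_torus_exp {k : ℕ} (hk : j + k ≤ P.m + P.K) (c a : ℝ) (h : GaugeTransf P j U1) (u' : GaugeField P j U1)
    (ψ ψinv : CoarseSpK P j k) (hψinv : ∀ y, ψ y = toC (h (cornerIter k y)) * ψinv y) :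
    ∫ φ : HiggsField P j, Real.exp (-(scalarForm (Dlin c (GaugeField.gaugeAct h u')) (QlinK (GaugeField.gaugeAct h u') k) a ψ
        (WithLp.toLp 2 φ))) =
      ∫ φ : HiggsField P j, Real.exp (-(scalarForm (Dlin c u') (QlinK u' k) a ψinv (WithLp.toLp 2 φ))) :=
  eq634_torus hk c a h u' ψ ψinv hψinv (fun t => Real.exp (-t))

/-- The corner-point rotation `ψinv = h^{−1}ψ` of `eq634_torus` exists (and is the printed `e^{−iω}ψ`): `ψinv(y) = h(cornerIter k y)^{−1}ψ(y)`
(so `eq634_torus` applies to EVERY `ψ`). [cite: BalabanImbrieJaffe1985, (6.3.4) p.320] -/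
theorem psi_eq_twist_corner (k : ℕ) (h : GaugeTransf P j U1) (ψ : CoarseSpK P j k) (y : Balaban1983to89.Site P (j + k)) :
    ψ y = toC (h (cornerIter k y)) * (toC ((h (cornerIter k y))⁻¹) * ψ y) := by
  rw [← mul_assoc, ← toC_mul, mul_inv_cancel, toC_one, one_mul]

end

end Literature.MathematicalPhysics.QuantumFieldTheory.BalabanImbrieJaffe1984to88.BIJ85Eq634Torus
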